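import Summits.Parity.GeneralizedHardyLittlewood.Theorems.GreenTaoLevelTwoGITwoCyclicInverseBracketForm

/-!
# Route `GreenTaoLevelTwo`, crux `GITwo` (stmt-Parity-21275), line `birth`, stub `stub_cyclicInverse`:
# the phase `M(x)·x` as a bracket quadratic with frequencies in `S` only (GT08a arXiv Prop. 54,
# (phin-expand))

Sixty-first helper file toward the XL stub `stub_cyclicInverse` (B. Green, T. Tao, *An inverse
theorem for the Gowers `U³(G)` norm*, arXiv:math/0503014, Thm. 68 = PEMS 51 (2008) Thm. 12.8).
Block D15, complement to `…BracketForm`: arXiv Prop. 54 produces a bracket quadratic with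
`Freq(φ̃) ⊆ S` — both progression coordinates are expanded in the brackets `{ξ·x}`, `ξ ∈ S`
("`φ(l₁v₁+…+l_dv_d) = ∑ lᵢlⱼλᵢⱼ + ∑ lᵢηᵢ + c`", then "`lᵢ = ∑_ξ u_{iξ}{ξ·x}`").  This matters for
Thm. 68: the cutoffs `χ(ξ·n)` available from the Bohr set are exactly those of the frequencies in
`S` (arXiv Lemma 69 needs `χ²(ξn)χ²(ξ'n)` next to `e(a{ξn}{ξ'n})`).  For the explicit phase
`M(x)·x` with `x = ∑ cᵢvᵢ`, `M x = ∑ cⱼ M(vⱼ)`: `M(x)·x/N = ∑_{i,j} cᵢcⱼ θᵢⱼ (mod 1)`,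
`θᵢⱼ = valMinAbs(M(vᵢ) vⱼ)/N`, and with `cᵢ = ∑_l a_{il} m_l(x)`:

* `stdAddChar_mul_self_eq_prod_coords` — `e(M(x)x/N) = ∏_{i,j} e(cᵢ cⱼ θᵢⱼ)`;
* `exp_coord_mul_eq_prod`, `exp_coord_mul_coord_eq_prod` — substitution of the dual formula:
  `e(cⱼ θ) = ∏_l e(a_{jl} m_l θ)`, `e(cᵢcⱼ θ) = ∏_{l,l'} e(a_{il} a_{jl'} m_l m_{l'} θ)`;
* `stdAddChar_mul_self_eq_prod_bracket_freq` — the packaged statement on `B(ξ,ρ)`.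

References: [GreenTao2008U3Inverse] arXiv:math/0503014, §10, Prop. 54 ((phin-expand)).
-/

noncomputable section

namespace Summit.Parity.GeneralizedHardyLittlewood.GreenTaoLevelTwoGITwoCyclicInverse

open Finset Literature.Algebra.EuclideanLattices

/-- `e(M(x)·x/N) = ∏_{i,j} e(cᵢ cⱼ · valMinAbs(M(vᵢ) vⱼ) / N)` when `x = ∑ cᵢ vᵢ` and
`M x = ∑ cⱼ M(vⱼ)`. [cite: GreenTao2008U3Inverse, §10, Prop. 54 ((phin-expand))] -/
theorem stdAddChar_mul_self_eq_prod_coords {N : ℕ} [NeZero N] {d : ℕ} (c : Fin d → ℤ)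
    (v : Fin d → ZMod N) (μ : ZMod N → ZMod N) {x : ZMod N}
    (hx : x = ∑ j, (c j : ZMod N) * v j) (hμ : μ x = ∑ j, (c j : ZMod N) * μ (v j)) :
    (ZMod.stdAddChar (μ x * x) : ℂ) =
      ∏ i, ∏ j, Complex.exp (2 * Real.pi * Complex.I *
        ((c i : ℝ) * (c j : ℝ) * (((μ (v i) * v j).valMinAbs : ℝ) / N))) := by
  have h1 : μ x * x = (((∑ i, ∑ j, c i * c j * (μ (v i) * v j).valMinAbs : ℤ)) : ZMod N) := by
    rw [hμ, hx, Finset.sum_mul, Int.cast_sum]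
    refine Finset.sum_congr rfl fun i _ => ?_
    rw [Finset.mul_sum, Int.cast_sum]
    refine Finset.sum_congr rfl fun j _ => ?_
    simp only [Int.cast_mul, ZMod.coe_valMinAbs]
    ring
  rw [h1, ZMod.stdAddChar_coe]
  simp_rw [← Complex.exp_sum]
  congr 1
  push_cast
  rw [div_eq_mul_inv, mul_assoc, Finset.sum_mul, Finset.mul_sum]
  refine Finset.sum_congr rfl fun i _ => ?_
  rw [Finset.sum_mul, Finset.mul_sum]
  refine Finset.sum_congr rfl fun j _ => ?_
  ring

/-- Substituting the dual formula in a linear bracket: `e(cⱼ θ) = ∏_l e(a_{jl} m_l θ)`.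
[cite: GreenTao2008U3Inverse, §10, Prop. 54] -/
theorem exp_coord_mul_eq_prod {d : ℕ} {a : Fin d → Fin d → ℝ} {m : Fin d → ℝ} {c : Fin d → ℝ}
    (hdual : ∀ j, c j = ∑ l, a j l * m l) (j : Fin d) (θ : ℂ) :
    Complex.exp (2 * Real.pi * Complex.I * (c j * θ)) =
      ∏ l, Complex.exp (2 * Real.pi * Complex.I * (a j l * m l * θ)) := by
  rw [hdual j, ← Complex.exp_sum]
  congr 1
  push_cast
  rw [Finset.sum_mul, Finset.mul_sum]

/-- Substituting the dual formula in a quadratic bracket: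
`e(cᵢ cⱼ θ) = ∏_l ∏_{l'} e(a_{il} a_{jl'} m_l m_{l'} θ)`. [cite: GreenTao2008U3Inverse, §10, Prop. 54] -/
theorem exp_coord_mul_coord_eq_prod {d : ℕ} {a : Fin d → Fin d → ℝ} {m : Fin d → ℝ}
    {c : Fin d → ℝ} (hdual : ∀ j, c j = ∑ l, a j l * m l) (i j : Fin d) (θ : ℂ) :
    Complex.exp (2 * Real.pi * Complex.I * (c i * c j * θ)) =
      ∏ l, ∏ l', Complex.exp (2 * Real.pi * Complex.I * (a i l * a j l' * m l * m l' * θ)) := by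
  rw [hdual i, hdual j]
  simp_rw [← Complex.exp_sum]
  congr 1
  push_cast
  rw [Finset.sum_mul, Finset.sum_mul, Finset.mul_sum]
  refine Finset.sum_congr rfl fun l _ => ?_
  rw [Finset.mul_sum, Finset.sum_mul, Finset.mul_sum]
  refine Finset.sum_congr rfl fun l' _ => ?_
  ring

/-- **arXiv Prop. 54 for the phase `M(x)·x`, frequencies in `S` only.**  Under the hypotheses of
`stdAddChar_mul_self_eq_prod_bracket` (`N` prime, `ξ l₀ ≠ 0`, generators `wⱼ ≡ vⱼξ` with the
coordinate property, dual coefficients `a`, `μ` additive on `B(ξ,ρ₀)`, `ρ·2^{d(d+2)}d² < ρ₀`), every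
`x ∈ B(ξ,ρ)` has integer coordinates `c` with `x = ∑ cⱼvⱼ`, `μ x = ∑ cⱼ μ(vⱼ)`,
`cⱼ = ∑_l a_{jl} valMinAbs(xξ_l)`, and
`e(μ(x)x/N) = ∏_{i,j} ∏_{l,l'} e(a_{il} a_{jl'} valMinAbs(xξ_l) valMinAbs(xξ_{l'}) valMinAbs(μ(vᵢ)vⱼ)/N)`
— a product of `d⁴` bracket quadratic monomials in the `{ξ_l x/N}` alone.
[cite: GreenTao2008U3Inverse, §10, Prop. 54] -/
theorem stdAddChar_mul_self_eq_prod_bracket_freq {N : ℕ} [Fact N.Prime] {d : ℕ}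
    (ξ : Fin d → ZMod N) (l₀ : Fin d) (hξ : ξ l₀ ≠ 0) {w : Fin d → Fin d → ℤ} {v : Fin d → ZMod N}
    (hv : ∀ j l, ((w j l : ℤ) : ZMod N) = v j * ξ l)
    (hcoord : ∀ m : Fin d → ℤ, (∃ x : ZMod N, ∀ l, ((m l : ℤ) : ZMod N) = x * ξ l) →
      ∃ c : Fin d → ℤ, m = ∑ j, c j • w j ∧
        ∀ j, |(c j : ℝ)| * ‖intVecToEuclidean d (w j)‖ ≤
          2 ^ (d * (d + 2)) * ‖intVecToEuclidean d m‖)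
    {a : Fin d → Fin d → ℝ} (ha : ∀ (u : Fin d → ℝ) (j : Fin d),
      u j = ∑ l, a j l * ∑ i, u i * (w i l : ℝ))
    {ρ₀ ρ : ℝ} (hρ₀ : 0 < ρ₀) (hρ : ρ * (2 ^ (d * (d + 2)) * d * d) < ρ₀)
    (μ : ZMod N → ZMod N)
    (hadd : ∀ a b : ZMod N, (∀ l, ‖ZMod.toAddCircle (a * ξ l)‖ < ρ₀) →
      (∀ l, ‖ZMod.toAddCircle (b * ξ l)‖ < ρ₀) →
      (∀ l, ‖ZMod.toAddCircle ((a + b) * ξ l)‖ < ρ₀) → μ (a + b) = μ a + μ b)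
    {x : ZMod N} (hx : ∀ l, ‖ZMod.toAddCircle (x * ξ l)‖ < ρ) :
    ∃ c : Fin d → ℤ, x = ∑ j, (c j : ZMod N) * v j ∧
      μ x = ∑ j, (c j : ZMod N) * μ (v j) ∧
      (∀ j, (c j : ℝ) = ∑ l, a j l * ((x * ξ l).valMinAbs : ℝ)) ∧
      (ZMod.stdAddChar (μ x * x) : ℂ) =
        ∏ i, ∏ j, ∏ l, ∏ l', Complex.exp (2 * Real.pi * Complex.I *
          (a i l * a j l' * ((x * ξ l).valMinAbs : ℝ) * ((x * ξ l').valMinAbs : ℝ) *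
            (((μ (v i) * v j).valMinAbs : ℝ) / N))) := by
  haveI : NeZero N := ⟨(Fact.out : N.Prime).ne_zero⟩
  obtain ⟨c, hxc, hμ, hdual, -⟩ :=
    stdAddChar_mul_self_eq_prod_bracket ξ l₀ hξ hv hcoord ha hρ₀ hρ μ hadd hx
  refine ⟨c, hxc, hμ, hdual, ?_⟩
  rw [stdAddChar_mul_self_eq_prod_coords c v μ hxc hμ]
  refine Finset.prod_congr rfl fun i _ => Finset.prod_congr rfl fun j _ => ?_
  exact exp_coord_mul_coord_eq_prod (m := fun l => ((x * ξ l).valMinAbs : ℝ))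
    (c := fun j => (c j : ℝ)) hdual i j _

end Summit.Parity.GeneralizedHardyLittlewood.GreenTaoLevelTwoGITwoCyclicInverse
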